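import Summits.HodgeConjecture.HodgeConjecture.Theorems.Ring2WeilCoverageTypeRelativeNormSign
import Summits.HodgeConjecture.HodgeConjecture.Theorems.Ring2WeilCoverageCyclotomicTwistedLevel56Yes
import Summits.HodgeConjecture.HodgeConjecture.Theorems.Ring2WeilCoverageWeilTypeBalance
import HarnessLib

/-!
# Weil-type family coverage — THE RELATIVE NORM-SIGN LAW AT `M = 56`, both directions: on `ℂ^Φ/Φ(ℤ[ζ₅₆])` the
# principal type `(ϖ₀)` occurs iff, at EACH of the two real places of `ℚ(√2)`, the twisted sign count of `Φ` and the
# sign of the relative norm `N_{ℚ(ζ₅₆)⁺/ℚ(√2)}(ϖ₀)` have matching parities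

research route conditional on HC_CM; not a corollary; Q11.4-sentence-2 already refuted in dim ≥ 3.

Ring 2, WEIL-TYPE FAMILY-COVERAGE CENSUS (`HOME/WEIL-FAMILY-COVERAGE.md` `## b01`, blocks b01.25 (A), b01.39 (the index-2 level
`56`: `ℂ^Φ/Φ(ℤ[ζ₅₆])` is principally polarisable iff both twisted counts are even, parts 37/40/41), b01.42; owner
ring2-b01), part 58d of the `Ring2WeilCoverage*` series — part 58c verbatim at `56`: the EXISTENCE half from part 40's
two-class unit supply (part 13's unit products; classes `C₊ = {χ₈ = +1}`, `C₋`), applied to the pattern of the skew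
element `ϖξ` (`ξ = ζ¹¹/Φ₅₆′(ζ)`, `ϖ` the image of `ϖ₀ ∈ 𝓞 K⁺`), and the OBSTRUCTION half from part 58:

* `ncard_on_negSet_eq_card_filter` — residue translation for an ARBITRARY `z ∈ K`: the number of `φ ∈ Φ` over the
  place of `φ₀` (`φ(s) = φ₀(s)`, `s = √2`) with `Im φ(z) < 0` is the number of residues of the negative set of `z` on
  `Φ` in the `χ₈`-class of `t₀` (parts 26b/37: `φ(s) = φ₀(s) ↔ (χ₈(t_φ) = −1 ↔ χ₈(t₀) = −1)`).
* **`exists_type_span_fiftySix_of_even_on`** — if the counts `#{φ ∈ Φ : φ(s) = φ±(s), Im φ(ϖξ) < 0}` over both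
  places (`Re φ₊(s) > 0`, `Re φ₋(s) < 0`) are even, then `ℂ^Φ/Φ(ℤ[ζ₅₆])` carries a `Φ`-positive divisor of type `(ϖ₀)`.
* **`exists_type_span_iff_even_on_fiftySix`** — for every CM type `Φ` and every `ϖ₀ ∈ 𝓞 K⁺ ∖ 0`: type `(ϖ₀)`
  occurs ⟺ both counts are even (⟹ by part 58's relative obstruction).
* **`exists_type_span_iff_fiftySix`** — THE LAW: type `(ϖ₀)` occurs ⟺
  (`#{φ ∈ Φ : φ(s) = φ₊(s), Im φ(ξ) < 0}` even ⟺ `Re φ₊(N_{K⁺/ℚ(s)}(ϖ₀)) > 0`) ∧ (the same at `φ₋`) — part 58's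
  hypothesis-free parity law at each place; with part 37's dictionary the two `ξ`-counts are the census's
  `|S_Φ ∩ C± ∩ N_odd|`.

HONEST FRAMING: torus-level statements about Shimura's divisors of type `(K; Φ; 𝔣₀)` [Sh98 §14.3 Prop. 4–5] on the
principal torus `ℂ^Φ/Φ(ℤ[ζ₅₆])`; nothing here is a statement about Hodge classes, `W_K`, general members or HC; `HC_CM` is
used nowhere.  No `def`, no named fact, no `sorry`.

References: [cite: Shimura1998, §14.3 Prop. 4–5, pp. 103–104]; census b01.25 (A) / b01.39 (seat-derived).
-/

noncomputable section

open scoped Classical nonZeroDivisors NumberField ComplexConjugate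
open NumberField NumberField.ComplexEmbedding Module FractionalIdeal Complex Polynomial Finset IntermediateField

namespace Summit.HodgeConjecture.Ring2WeilCoverage.TypeRelativeNormSignLevel56

open Literature.AlgebraicGeometry.Motives (CMType)
open Literature.AlgebraicGeometry.HodgeTheory (IsCMTypeSet)
open Literature.AlgebraicGeometry.ComplexMultiplication.CyclotomicCMType
  (exists_apply_eq_toCircle embedding_eq_of_apply_eq)
open Literature.NumberTheory.ComplexMultiplication
open Literature.NumberTheory.ComplexMultiplication.CMTypeLattice
open Summit.HodgeConjecture.Ring2WeilCoverage.CMTypeSignParity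
open Summit.HodgeConjecture.Ring2WeilCoverage.CMUnitSignature
open Summit.HodgeConjecture.Ring2WeilCoverage.TypeNormSign
open Summit.HodgeConjecture.Ring2WeilCoverage.TypeRelativeNormSign
open Summit.HodgeConjecture.Ring2WeilCoverage.TwistedUnitWitnesses (exists_units_sign_eq_on)
open Summit.HodgeConjecture.Ring2WeilCoverage.CyclotomicTwistedLevel56Yes
  (familyProperty_fiftySix pairProperty_fiftySix classFacts_fiftySix)
open Summit.HodgeConjecture.Ring2WeilCoverage.CyclotomicTwistedObstruction (apply_eq_apply_iff)
open Summit.HodgeConjecture.Ring2WeilCoverage.CyclotomicTwistedLevel56 (sq_sqrtTwo classes_fiftySix)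
open Summit.HodgeConjecture.Ring2WeilCoverage.ResidueDictionaryPiecesB (re_embedding_sqrtTwo_neg_iff)
open Summit.HodgeConjecture.Ring2WeilCoverage.WeilTypeBalance (ncard_inter_eq_card_filter)
open Summit.HodgeConjecture.Ring2WeilCoverage.CyclotomicDifferent (xi_ne_zero isOfType_one_xi_top)
open Summit.HodgeConjecture.Ring2WeilCoverage.CyclotomicPrincipalObstruction (complexConj_xi coprime_of_apply_eq_toCircle)

variable {K : Type} [Field K] [NumberField K] [IsCMField K] [IsCyclotomicExtension {56} ℚ K] {ζ : K}

/-- `𝐞(t) = exp(2πi t/56) ∈ ℂ` (`ZMod.toCircle`). -/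
local notation3 (prettyPrint := false) "𝐞 " t:max => ((ZMod.toCircle t : Circle) : ℂ)

/-- the census's skew generator `ξ = ζ¹¹/Φ₅₆′(ζ)` of `𝔡⁻¹`. -/
local notation3 (prettyPrint := false) "ξ" => (ζ ^ 11 * (aeval ζ (derivative (cyclotomic 56 ℚ)))⁻¹)

/-- the image in `K` of an integer `ϖ₀` of the maximal real subfield. -/
local notation3 (prettyPrint := false) "𝓇 " x:max => (algebraMap (𝓞 (maximalRealSubfield K)) K x)

/-- `Re φ₀|_{K⁺}(N_{K⁺/ℚ(s)}(x))`. -/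
local notation3 (prettyPrint := false) "RN[" φ₀ "," s "] " x:max =>
  (((RingHom.comp (φ₀ : K →+* ℂ) (algebraMap (maximalRealSubfield K) K))
    (algebraMap (ℚ⟮(s : maximalRealSubfield K)⟯) (maximalRealSubfield K)
      (Algebra.norm (ℚ⟮(s : maximalRealSubfield K)⟯) (x : maximalRealSubfield K)))).re)

/-- the dictionary predicate of part 26b for `√2`: «`χ₈(t) = −1`» (`t ≡ ±3 (mod 8)`). -/
local notation3 (prettyPrint := false) "NR13 " t:max =>
  (({1, 7} : Finset (ZMod 8)).image (· * (((ZMod.val t : ℕ) : ℕ) : ZMod 8)) = ({3, 5} : Finset (ZMod 8)))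

/-- the sign predicate of part 13's `u(a,b,h) = ζ^h(1 − ζ^a)(1 − ζ^b)` at the unit residue `t` (part 40's family). -/
local notation3 (prettyPrint := false) "sgn" =>
  (fun (x : ℕ × ℕ × ℕ) (t : ZMod 56) => (56 < x.1 * ZMod.val t % (2 * 56) ↔ 56 < x.2.1 * ZMod.val t % (2 * 56)))

/-- admissibility of a triple `x = (a, b, h)` (part 13). -/
local notation3 (prettyPrint := false) "adm" =>
  (fun x : ℕ × ℕ × ℕ => ¬ 56 ∣ x.1 ∧ ¬ 56 ∣ x.2.1 ∧ (2 * x.2.2 + x.1 + x.2.1) % (2 * 56) = 0 ∧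
    ¬ IsPrimePow (56 / Nat.gcd 56 x.1) ∧ ¬ IsPrimePow (56 / Nat.gcd 56 x.2.1))

/-- the class `C₊ = {t : χ₈(t) = +1}` of unit residues mod `56`. -/
local notation3 (prettyPrint := false) "Cp" => ({1, 9, 15, 17, 23, 25, 31, 33, 39, 41, 47, 55} : Finset (ZMod 56))

/-- `√2 ∈ ℚ(ζ₅₆)` as part 26b writes it (`n = 56`: `ζ^{n/8} = ζ⁷`). -/
local notation3 (prettyPrint := false) "S13" => ((ζ : K) ^ (56 / 8) + ζ ^ (56 / 8 * 7))

/-! ### §1 Residue translation of the count over one place, for an arbitrary `z` -/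

omit [NumberField K] [IsCMField K] [IsCyclotomicExtension {56} ℚ K] in
/-- `S13 = ζ⁷ + ζ⁴⁹` (here `S13` denotes part 26b's `√2`). [folklore] -/
theorem sqrtThirteen_eq : (S13 : K) = ζ ^ 7 + ζ ^ 49 := by
  norm_num

omit [IsCMField K] in
/-- **Residue translation over one place**: for `s = √2` (as `S13`), any `z ∈ K`, a CM type `Φ` and `φ₀ ζ = 𝐞(t₀)`:
`#{φ ∈ Φ : φ(s) = φ₀(s), Im φ(z) < 0} = #{t : (∃ σ ∈ Φ ∩ {Im σ(z) < 0}, σ ζ = 𝐞 t) ∧ (NR13 t ↔ NR13 t₀)}` (the bijection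
`φ ↦ t_φ`; `φ(s) = φ₀(s) ↔ (χ₈(t_φ) = −1 ↔ χ₈(t₀) = −1)`, parts 26b/36).
research route conditional on HC_CM; not a corollary; Q11.4-sentence-2 already refuted in dim ≥ 3. [folklore] -/
theorem ncard_on_negSet_eq_card_filter (hζ : IsPrimitiveRoot ζ 56) (Φ : CMType K) (z : K) {φ₀ : K →+* ℂ}
    {t₀ : ZMod 56} (hφ₀ : φ₀ ζ = 𝐞 t₀) :
    (Φ.1 ∩ {ψ : K →+* ℂ | ψ S13 = φ₀ S13 ∧ (ψ z).im < 0}).ncard =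
      ((Finset.univ.filter fun t : ZMod 56 => ∃ σ ∈ (Φ.1 ∩ {ψ : K →+* ℂ | (ψ z).im < 0}), σ ζ = 𝐞 t).filter
        fun t => (NR13 t ↔ NR13 t₀)).card := by
  classical
  have hμ : IsPrimitiveRoot (ζ ^ 7) 8 := hζ.pow (by norm_num) (by norm_num)
  have hs2 : (S13 : K) ^ 2 = ((2 : ℕ) : K) := by
    rw [sqrtThirteen_eq]
    have := sq_sqrtTwo hμ
    have e : (ζ : K) ^ 7 + ζ ^ 49 = ζ ^ 7 + (ζ ^ 7) ^ 7 := by ring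
    rw [e, this]; norm_num
  have hdict : ∀ {φ : K →+* ℂ} {t : ZMod 56}, φ ζ = 𝐞 t → t.val.Coprime 56 →
      ((((φ S13).re < 0 ↔ NR13 t) ∧ (φ S13).re ≠ 0) ∧ (φ S13).im = 0) :=
    fun hφ ht => re_embedding_sqrtTwo_neg_iff (n := 56) (by norm_num) hφ ht
  have ht₀ : t₀.val.Coprime 56 := coprime_of_apply_eq_toCircle hζ hφ₀
  rw [ncard_inter_eq_card_filter hζ Φ (fun ψ => ψ S13 = φ₀ S13 ∧ (ψ z).im < 0)
    (fun t => (NR13 t ↔ NR13 t₀) ∧ ∃ σ : K →+* ℂ, σ ζ = 𝐞 t ∧ (σ z).im < 0)]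
  · congr 1
    ext t
    simp only [Finset.mem_filter, Finset.mem_univ, true_and, Set.mem_inter_iff, Set.mem_setOf_eq]
    constructor
    · rintro ⟨⟨σ, hσΦ, hσt⟩, hP, τ, hτt, hτ⟩
      have : τ = σ := embedding_eq_of_apply_eq hζ (hτt.trans hσt.symm)
      subst this
      exact ⟨⟨τ, ⟨hσΦ, hτ⟩, hσt⟩, hP⟩
    · rintro ⟨⟨σ, ⟨hσΦ, hσ⟩, hσt⟩, hP⟩
      exact ⟨⟨σ, hσΦ, hσt⟩, hP, σ, hσt, hσ⟩
  · intro φ t hφ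
    have ht : t.val.Coprime 56 := coprime_of_apply_eq_toCircle hζ hφ
    rw [apply_eq_apply_iff hs2 (fun t : ZMod 56 => NR13 t) hdict hφ ht hφ₀ ht₀]
    constructor
    · rintro ⟨hP, hneg⟩
      exact ⟨hP, φ, hφ, hneg⟩
    · rintro ⟨hP, σ, hσt, hσ⟩
      have : σ = φ := embedding_eq_of_apply_eq hζ (hσt.trans hφ.symm)
      subst this
      exact ⟨hP, hσ⟩

/-! ### §2 Existence from two even counts -/

/-- **EXISTENCE AT `56`**: let `s ∈ K⁺` be `√2` (`(s : K) = S13`), `φ₊`, `φ₋` embeddings of `K` with `Re φ₊(s) > 0`,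
`Re φ₋(s) < 0`, and `ϖ₀ ∈ 𝓞 K⁺ ∖ 0`.  If the counts `#{φ ∈ Φ : φ(s) = φ±(s), Im φ(ϖξ) < 0}` over BOTH places are even,
then `ℂ^Φ/Φ(ℤ[ζ₅₆])` carries a `Φ`-positive divisor of type `(ϖ₀)`: part 40's two-class unit supply gives a real unit
`u` with `Re u^φ < 0 ⟺ Im (ϖξ)^φ < 0` on `Φ`, and `X_{uϖξ}` has type `(ϖ₀)` (Shimura Prop. 5).
research route conditional on HC_CM; not a corollary; Q11.4-sentence-2 already refuted in dim ≥ 3. [cite: Shimura1998, §14.3 Prop. 4–5, pp. 103–104] -/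
theorem exists_type_span_fiftySix_of_even_on (hζ : IsPrimitiveRoot ζ 56) (Φ : CMType K)
    (s : maximalRealSubfield K) (hs : (s : K) = S13) {ϖ₀ : 𝓞 (maximalRealSubfield K)} (hϖ0 : ϖ₀ ≠ 0)
    (φp φm : K →+* ℂ) (hp : 0 < (φp (s : K)).re) (hm : (φm (s : K)).re < 0)
    (hevp : Even ((Φ.1 ∩ {ψ : K →+* ℂ | ψ (s : K) = φp (s : K) ∧ (ψ (𝓇 ϖ₀ * ξ)).im < 0}).ncard))
    (hevm : Even ((Φ.1 ∩ {ψ : K →+* ℂ | ψ (s : K) = φm (s : K) ∧ (ψ (𝓇 ϖ₀ * ξ)).im < 0}).ncard)) :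
    ∃ ζ' : K, IsCMField.complexConj K ζ' = -ζ' ∧ (∀ φ : Φ.1, 0 < (φ.1 ζ').im) ∧
        IsOfType (1 : (FractionalIdeal (𝓞 K)⁰ K)ˣ) ζ' (Ideal.span {ϖ₀}) := by
  classical
  have hg : Nat.totient 56 = 2 * (11 + 1) := by decide
  obtain ⟨-, hCsym, -, -, -, -, -, -⟩ := classFacts_fiftySix
  have hCp := classes_fiftySix.1
  -- the skew element and its type
  have hϖ : IsCMField.complexConj K (𝓇 ϖ₀) = 𝓇 ϖ₀ := complexConj_algebraMap_ringOfIntegers ϖ₀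
  have hϖne : 𝓇 ϖ₀ ≠ 0 := algebraMap_ringOfIntegers_ne_zero hϖ0
  have hskew : IsCMField.complexConj K (𝓇 ϖ₀ * ξ) = -(𝓇 ϖ₀ * ξ) := complexConj_realMul ϖ₀ (complexConj_xi hζ hg)
  have hne : 𝓇 ϖ₀ * ξ ≠ 0 := mul_ne_zero hϖne (xi_ne_zero hζ 11)
  have hT : IsOfType (1 : (FractionalIdeal (𝓞 K)⁰ K)ˣ) (𝓇 ϖ₀ * ξ) (Ideal.span {ϖ₀}) := by
    have h := isOfType_realMul 1 ϖ₀ (isOfType_one_xi_top hζ 11)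
    rwa [Ideal.mul_top] at h
  -- residues of `φ±` and the dictionary at them
  obtain ⟨tp, htp, hφp⟩ := exists_apply_eq_toCircle hζ φp
  obtain ⟨tm, htm, hφm⟩ := exists_apply_eq_toCircle hζ φm
  have hdict : ∀ {φ : K →+* ℂ} {t : ZMod 56}, φ ζ = 𝐞 t → t.val.Coprime 56 →
      ((((φ S13).re < 0 ↔ NR13 t) ∧ (φ S13).re ≠ 0) ∧ (φ S13).im = 0) :=
    fun hφ ht => re_embedding_sqrtTwo_neg_iff (n := 56) (by norm_num) hφ ht
  have hNp : ¬ NR13 tp := fun h => by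
    have := ((hdict hφp htp).1.1).mpr h
    rw [← hs] at this
    exact (lt_asymm this) hp
  have hNm : NR13 tm := by
    have := (hdict hφm htm).1.1
    rw [← hs] at this
    exact this.mp hm
  -- the two class counts of the residue set of the pattern are the two place counts
  have hJ : ∀ t : ZMod 56, t ∈ (Finset.univ.filter fun t : ZMod 56 =>
      ∃ σ ∈ (Φ.1 ∩ {ψ : K →+* ℂ | (ψ (𝓇 ϖ₀ * ξ)).im < 0}), σ ζ = 𝐞 t) ↔
      ∃ σ ∈ (Φ.1 ∩ {ψ : K →+* ℂ | (ψ (𝓇 ϖ₀ * ξ)).im < 0}), σ ζ = 𝐞 t := fun t => by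
    simp only [Finset.mem_filter, Finset.mem_univ, true_and]
  have hcp : ((Finset.univ.filter fun t : ZMod 56 =>
      ∃ σ ∈ (Φ.1 ∩ {ψ : K →+* ℂ | (ψ (𝓇 ϖ₀ * ξ)).im < 0}), σ ζ = 𝐞 t).filter fun t => t ∈ Cp).card =
      (Φ.1 ∩ {ψ : K →+* ℂ | ψ (s : K) = φp (s : K) ∧ (ψ (𝓇 ϖ₀ * ξ)).im < 0}).ncard := by
    rw [hs, ncard_on_negSet_eq_card_filter hζ Φ (𝓇 ϖ₀ * ξ) hφp]
    refine congrArg Finset.card (Finset.filter_congr fun t ht => ?_)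
    obtain ⟨σ, -, hσt⟩ := (hJ t).mp ht
    have htu : t.val.Coprime 56 := coprime_of_apply_eq_toCircle hζ hσt
    rw [hCp t htu]
    simp only [hNp, iff_false]
  have hcm : ((Finset.univ.filter fun t : ZMod 56 =>
      ∃ σ ∈ (Φ.1 ∩ {ψ : K →+* ℂ | (ψ (𝓇 ϖ₀ * ξ)).im < 0}), σ ζ = 𝐞 t).filter fun t => t ∉ Cp).card =
      (Φ.1 ∩ {ψ : K →+* ℂ | ψ (s : K) = φm (s : K) ∧ (ψ (𝓇 ϖ₀ * ξ)).im < 0}).ncard := by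
    rw [hs, ncard_on_negSet_eq_card_filter hζ Φ (𝓇 ϖ₀ * ξ) hφm]
    refine congrArg Finset.card (Finset.filter_congr fun t ht => ?_)
    obtain ⟨σ, -, hσt⟩ := (hJ t).mp ht
    have htu : t.val.Coprime 56 := coprime_of_apply_eq_toCircle hζ hσt
    rw [hCp t htu]
    simp only [hNm, iff_true, iff_false, not_not]
  have hevC := hcp ▸ hevp
  have hevC' := hcm ▸ hevm
  -- the unit
  obtain ⟨u, hu, hsign⟩ := exists_units_sign_eq_on sgn adm Cp hζ (familyProperty_fiftySix hζ)
    pairProperty_fiftySix hCsym Φ (Φ.1 ∩ {ψ : K →+* ℂ | (ψ (𝓇 ϖ₀ * ξ)).im < 0}) Set.inter_subset_left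
    (Finset.univ.filter fun t : ZMod 56 => ∃ σ ∈ (Φ.1 ∩ {ψ : K →+* ℂ | (ψ (𝓇 ϖ₀ * ξ)).im < 0}), σ ζ = 𝐞 t)
    hJ hevC hevC'
  refine (exists_pos_isOfType_iff_exists_units Φ 1 hskew hne hT).mpr ⟨u, hu, fun φ => ?_⟩
  have hre := re_embedding_ne_zero_of_real hu (coe_units_ne_zero u) φ.1
  have him := im_embedding_ne_zero_of_skew hskew hne φ.1
  have hiff : (φ.1 ((u : 𝓞 K) : K)).re < 0 ↔ (φ.1 (𝓇 ϖ₀ * ξ)).im < 0 := by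
    rw [hsign φ.1 φ.2]
    simp only [Set.mem_inter_iff, Set.mem_setOf_eq]
    exact ⟨fun h => h.2, fun h => ⟨φ.2, h⟩⟩
  rcases lt_or_gt_of_ne him with hlt | hgt
  · exact mul_pos_of_neg_of_neg (hiff.mpr hlt) hlt
  · have hre' : 0 < (φ.1 ((u : 𝓞 K) : K)).re :=
      lt_of_le_of_ne (not_lt.mp fun h => (lt_asymm (hiff.mp h)) hgt) hre.symm
    exact mul_pos hre' hgt

/-! ### §3 The law at `56` -/

/-- **Type `(ϖ₀)` on `ℂ^Φ/Φ(ℤ[ζ₅₆])` ⟺ both place counts of `ϖξ` are even** (every CM type `Φ`, every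
`ϖ₀ ∈ 𝓞 K⁺ ∖ 0`; ⟹ part 58 `relNorm_units_pos_fiftySix` + `even_ncard_on_of_exists`,
⟸ §2).
research route conditional on HC_CM; not a corollary; Q11.4-sentence-2 already refuted in dim ≥ 3. [cite: Shimura1998, §14.3 Prop. 4–5, pp. 103–104] -/
theorem exists_type_span_iff_even_on_fiftySix (hζ : IsPrimitiveRoot ζ 56) (Φ : CMType K)
    (s : maximalRealSubfield K) (hs : (s : K) = S13) {ϖ₀ : 𝓞 (maximalRealSubfield K)} (hϖ0 : ϖ₀ ≠ 0)
    (φp φm : K →+* ℂ) (hp : 0 < (φp (s : K)).re) (hm : (φm (s : K)).re < 0) :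
    (∃ ζ' : K, IsCMField.complexConj K ζ' = -ζ' ∧ (∀ φ : Φ.1, 0 < (φ.1 ζ').im) ∧
        IsOfType (1 : (FractionalIdeal (𝓞 K)⁰ K)ˣ) ζ' (Ideal.span {ϖ₀})) ↔
      (Even ((Φ.1 ∩ {ψ : K →+* ℂ | ψ (s : K) = φp (s : K) ∧ (ψ (𝓇 ϖ₀ * ξ)).im < 0}).ncard) ∧
        Even ((Φ.1 ∩ {ψ : K →+* ℂ | ψ (s : K) = φm (s : K) ∧ (ψ (𝓇 ϖ₀ * ξ)).im < 0}).ncard)) := by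
  have hg : Nat.totient 56 = 2 * (11 + 1) := by decide
  have hs' : (s : K) = ζ ^ 7 + ζ ^ 49 := by rw [hs, sqrtThirteen_eq]
  have hskew : IsCMField.complexConj K (𝓇 ϖ₀ * ξ) = -(𝓇 ϖ₀ * ξ) := complexConj_realMul ϖ₀ (complexConj_xi hζ hg)
  have hne : 𝓇 ϖ₀ * ξ ≠ 0 := mul_ne_zero (algebraMap_ringOfIntegers_ne_zero hϖ0) (xi_ne_zero hζ 11)
  have hT : IsOfType (1 : (FractionalIdeal (𝓞 K)⁰ K)ˣ) (𝓇 ϖ₀ * ξ) (Ideal.span {ϖ₀}) := by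
    have h := isOfType_realMul 1 ϖ₀ (isOfType_one_xi_top hζ 11)
    rwa [Ideal.mul_top] at h
  refine ⟨fun h => ⟨?_, ?_⟩, fun h => exists_type_span_fiftySix_of_even_on hζ Φ s hs hϖ0 φp φm hp hm h.1 h.2⟩
  · exact even_ncard_on_of_exists Φ 1 hskew hne hT s (relNorm_units_pos_fiftySix hζ s hs') h φp
  · exact even_ncard_on_of_exists Φ 1 hskew hne hT s (relNorm_units_pos_fiftySix hζ s hs') h φm

/-- **THE RELATIVE NORM-SIGN LAW AT `56`.**  For every CM type `Φ` of `K ⊇ ℚ(ζ₅₆)`, every real `ϖ₀ ∈ 𝓞 K⁺ ∖ 0`, and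
embeddings `φ₊`, `φ₋` reading the two real places of `ℚ(√2)` (`Re φ₊(s) > 0 > Re φ₋(s)`, `s = √2`): **`ℂ^Φ/Φ(ℤ[ζ₅₆])`
carries a `Φ`-positive divisor of type `(ϖ₀)` iff (`#{φ ∈ Φ : φ(s) = φ₊(s), Im φ(ξ) < 0}` even ⟺
`Re φ₊(N_{K⁺/ℚ(s)}(ϖ₀)) > 0`) and (`#{φ ∈ Φ : φ(s) = φ₋(s), Im φ(ξ) < 0}` even ⟺ `Re φ₋(N_{K⁺/ℚ(s)}(ϖ₀)) > 0`)** —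
the two `ξ`-counts are the census's `|S_Φ ∩ C₊ ∩ N_odd|`, `|S_Φ ∩ C₋ ∩ N_odd|` (part 36 `ncard_inter_negSet_on_eq`), so a
type `(ϖ₀)` flips exactly those of part 41's two parities at whose place the relative norm of `ϖ₀` is negative.
research route conditional on HC_CM; not a corollary; Q11.4-sentence-2 already refuted in dim ≥ 3. [cite: Shimura1998, §14.3 Prop. 4–5, pp. 103–104] -/
theorem exists_type_span_iff_fiftySix (hζ : IsPrimitiveRoot ζ 56) (Φ : CMType K)
    (s : maximalRealSubfield K) (hs : (s : K) = S13) {ϖ₀ : 𝓞 (maximalRealSubfield K)} (hϖ0 : ϖ₀ ≠ 0)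
    (φp φm : K →+* ℂ) (hp : 0 < (φp (s : K)).re) (hm : (φm (s : K)).re < 0) :
    (∃ ζ' : K, IsCMField.complexConj K ζ' = -ζ' ∧ (∀ φ : Φ.1, 0 < (φ.1 ζ').im) ∧
        IsOfType (1 : (FractionalIdeal (𝓞 K)⁰ K)ˣ) ζ' (Ideal.span {ϖ₀})) ↔
      ((Even ((Φ.1 ∩ {ψ : K →+* ℂ | ψ (s : K) = φp (s : K) ∧ (ψ ξ).im < 0}).ncard) ↔ 0 < RN[φp, s] ϖ₀) ∧
        (Even ((Φ.1 ∩ {ψ : K →+* ℂ | ψ (s : K) = φm (s : K) ∧ (ψ ξ).im < 0}).ncard) ↔ 0 < RN[φm, s] ϖ₀)) := by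
  have hg : Nat.totient 56 = 2 * (11 + 1) := by decide
  rw [exists_type_span_iff_even_on_fiftySix hζ Φ s hs hϖ0 φp φm hp hm,
    even_ncard_negSet_on_realMul_iff Φ s φp hϖ0 (complexConj_xi hζ hg) (xi_ne_zero hζ 11),
    even_ncard_negSet_on_realMul_iff Φ s φm hϖ0 (complexConj_xi hζ hg) (xi_ne_zero hζ 11)]

end Summit.HodgeConjecture.Ring2WeilCoverage.TypeRelativeNormSignLevel56

end
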